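import Summits.MatrixMultiplication.MatrixMultiplication.Theorems.AbelianSTPPCensusShapeCertVQFinalS
import Summits.MatrixMultiplication.MatrixMultiplication.Theorems.AbelianSTPPCensusLeafTE417Closed
import Summits.MatrixMultiplication.MatrixMultiplication.Theorems.AbelianSTPPCensusShapeCertVQEvalS418
import Summits.MatrixMultiplication.MatrixMultiplication.Theorems.AbelianSTPPCensusShapeCertVQEvalS419
import Summits.MatrixMultiplication.MatrixMultiplication.Theorems.AbelianSTPPCensusShapeCertVQEvalS420
import Summits.MatrixMultiplication.MatrixMultiplication.Theorems.AbelianSTPPCensusShapeCertVQEvalS421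
import Summits.MatrixMultiplication.MatrixMultiplication.Theorems.AbelianSTPPCensusShapeCertVQEvalS422
import Summits.MatrixMultiplication.MatrixMultiplication.Theorems.AbelianSTPPCensusShapeCertVQEvalS423
import Summits.MatrixMultiplication.MatrixMultiplication.Theorems.AbelianSTPPCensusShapeCertVQEvalS424
import Summits.MatrixMultiplication.MatrixMultiplication.Theorems.AbelianSTPPCensusShapeCertVQEvalS425
import Summits.MatrixMultiplication.MatrixMultiplication.Theorems.AbelianSTPPCensusShapeCertVQEvalS426
import Summits.MatrixMultiplication.MatrixMultiplication.Theorems.AbelianSTPPCensusShapeCertVQEvalS427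
import Summits.MatrixMultiplication.MatrixMultiplication.Theorems.AbelianSTPPCensusShapeCertVQEvalS428
import Summits.MatrixMultiplication.MatrixMultiplication.Theorems.AbelianSTPPCensusShapeCertVQEvalS429
import Summits.MatrixMultiplication.MatrixMultiplication.Theorems.AbelianSTPPCensusShapeCertVQEvalS430
import Summits.MatrixMultiplication.MatrixMultiplication.Theorems.AbelianSTPPCensusShapeCertVQEvalS431
import Summits.MatrixMultiplication.MatrixMultiplication.Theorems.AbelianSTPPCensusShapeCertVQEvalS432
import Summits.MatrixMultiplication.MatrixMultiplication.Theorems.AbelianSTPPCensusShapeCertVQEvalS433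
import Summits.MatrixMultiplication.MatrixMultiplication.Theorems.AbelianSTPPCensusShapeCertVQEvalS434
import Summits.MatrixMultiplication.MatrixMultiplication.Theorems.AbelianSTPPCensusShapeCertVQEvalS435
import Summits.MatrixMultiplication.MatrixMultiplication.Theorems.AbelianSTPPCensusShapeCertVQEvalS436
import Summits.MatrixMultiplication.MatrixMultiplication.Theorems.AbelianSTPPCensusShapeCertVQEvalS437
import Summits.MatrixMultiplication.MatrixMultiplication.Theorems.AbelianSTPPCensusShapeCertVQEvalS438
import Summits.MatrixMultiplication.MatrixMultiplication.Theorems.AbelianSTPPCensusShapeCertVQEvalS439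
import Summits.MatrixMultiplication.MatrixMultiplication.Theorems.AbelianSTPPCensusShapeCertVQEvalS440
import Summits.MatrixMultiplication.MatrixMultiplication.Theorems.AbelianSTPPCensusShapeCertVQEvalS441
import Summits.MatrixMultiplication.MatrixMultiplication.Theorems.AbelianSTPPCensusShapeCertVQEvalS442
import Summits.MatrixMultiplication.MatrixMultiplication.Theorems.AbelianSTPPCensusShapeCertVQEvalS443
import Summits.MatrixMultiplication.MatrixMultiplication.Theorems.AbelianSTPPCensusShapeCertVQEvalS444
import Summits.MatrixMultiplication.MatrixMultiplication.Theorems.AbelianSTPPCensusShapeCertVQEvalS445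
import Summits.MatrixMultiplication.MatrixMultiplication.Theorems.AbelianSTPPCensusShapeCertVQEvalS446
import Summits.MatrixMultiplication.MatrixMultiplication.Theorems.AbelianSTPPCensusShapeCertVQEvalS447
import Summits.MatrixMultiplication.MatrixMultiplication.Theorems.AbelianSTPPCensusShapeCertVQEvalS448
import Summits.MatrixMultiplication.MatrixMultiplication.Theorems.AbelianSTPPCensusShapeCertVQEvalS449
import Summits.MatrixMultiplication.MatrixMultiplication.Theorems.AbelianSTPPCensusShapeCertVQEvalS450
import Summits.MatrixMultiplication.MatrixMultiplication.Theorems.AbelianSTPPCensusShapeCertVQEvalS451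
import Summits.MatrixMultiplication.MatrixMultiplication.Theorems.AbelianSTPPCensusShapeCertVQEvalS452
import Summits.MatrixMultiplication.MatrixMultiplication.Theorems.AbelianSTPPCensusShapeCertVQEvalS453
import Summits.MatrixMultiplication.MatrixMultiplication.Theorems.AbelianSTPPCensusShapeCertVQEvalS454
import Summits.MatrixMultiplication.MatrixMultiplication.Theorems.AbelianSTPPCensusShapeCertVQEvalS455
import Summits.MatrixMultiplication.MatrixMultiplication.Theorems.AbelianSTPPCensusShapeCertVQEvalS456
import Summits.MatrixMultiplication.MatrixMultiplication.Theorems.AbelianSTPPCensusShapeCertVQEvalS457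
import Summits.MatrixMultiplication.MatrixMultiplication.Theorems.AbelianSTPPCensusShapeCertVQEvalS458
import Summits.MatrixMultiplication.MatrixMultiplication.Theorems.AbelianSTPPCensusShapeCertVQEvalS459
import Summits.MatrixMultiplication.MatrixMultiplication.Theorems.AbelianSTPPCensusShapeCertVQEvalS460
import Summits.MatrixMultiplication.MatrixMultiplication.Theorems.AbelianSTPPCensusShapeCertVQEvalS461
import Summits.MatrixMultiplication.MatrixMultiplication.Theorems.AbelianSTPPCensusShapeCertVQEvalS462
import Summits.MatrixMultiplication.MatrixMultiplication.Theorems.AbelianSTPPCensusShapeCertVQEvalS463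
import Summits.MatrixMultiplication.MatrixMultiplication.Theorems.AbelianSTPPCensusShapeCertVQEvalS464
import Summits.MatrixMultiplication.MatrixMultiplication.Theorems.AbelianSTPPCensusShapeCertVQEvalS465
import Summits.MatrixMultiplication.MatrixMultiplication.Theorems.AbelianSTPPCensusShapeCertVQEvalS466
import Summits.MatrixMultiplication.MatrixMultiplication.Theorems.AbelianSTPPCensusShapeCertVQEvalS467
import Summits.MatrixMultiplication.MatrixMultiplication.Theorems.AbelianSTPPCensusShapeCertVQEvalS468
import Summits.MatrixMultiplication.MatrixMultiplication.Theorems.AbelianSTPPCensusShapeCertVQEvalS469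
import Summits.MatrixMultiplication.MatrixMultiplication.Theorems.AbelianSTPPCensusShapeCertVQEvalS470
import Summits.MatrixMultiplication.MatrixMultiplication.Theorems.AbelianSTPPCensusShapeCertVQEvalS471
import Summits.MatrixMultiplication.MatrixMultiplication.Theorems.AbelianSTPPCensusVQWitness472
import Summits.MatrixMultiplication.MatrixMultiplication.Theorems.AbelianSTPPCensusVPShapeExclusionVP337

/-!
# Rung leaf F-M1.T_E beyond the vP wall — no abelian STPP host of order ≤ 471 beats exponent 5/2

Cell mm-stpp, rung F-M1; successor kernel item VQ-CERT (HOME/mm-stpp-eng-2/energy3/VQ-CERT-SPEC.md) filed in support of the closed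
crux item stmt-MatrixMultiplication-19191; seat mm-stpp-vp-p2 (gen 2).  Extends vp-p2 g1's `noAbelianSTPPHostUpTo_250_417`
(`…LeafTE417Closed`) by the orders `418 ≤ M ≤ 471` with the checker `ShapeCertVQ.checkQS` (`…ShapeCertVQDefsS`: g1's budgeted vQ
search with the saturated-regime E3⁺ continuation budget, the packing skip, the rest-budget first-member test, the child budget prune
and the blocked candidate walk with a level cap; soundness `…ShapeCertVQBudgetS` / `…TablesS` / `…SearchS`, path segments `…SearchPS`,
bridge `…ShapeCertVQFinalS`), kernel-evaluated order by order from planner-sized path segments (`…ShapeCertVQEvalS<M>a…`, `decide +kernel`,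
standard axioms, no `native_decide`) assembled in `…ShapeCertVQEvalS<M>`.  Hence `shapeExclusionVQ_338_471` and the named leaf
**`noAbelianSTPPHostUpTo_250_471 : NoAbelianSTPPHostUpTo (5/2) 471`**.
WHAT THIS IS NOT: no bound on `ω`; a rung leaf (finite range of a necessary condition), never summit credit; no existence claim; nothing
about orders `≥ 472` (the checker's verdict stays EXCLUDED through 471 in the seat's sizing and FAILS at 472, where the vQ-alive list
`(6,6,8)⁴+(3,4,4)` of `…VQWitness472` lives; the vQ instrument itself is blind there).
-/

set_option linter.dupNamespace false -- `MatrixMultiplication.MatrixMultiplication` (summit = problem, D-0017)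
set_option autoImplicit false

namespace Summit.MatrixMultiplication.MatrixMultiplication.Theorems

open Finset STPPThreeRoomEnergy

/-- **The vQ certificate `checkQS` holds at every order `418 ≤ M ≤ 471`.** -/
theorem ShapeCertVQ.checkQS_418_471 (M : ℕ) (h₁ : 418 ≤ M) (h₂ : M ≤ 471) : ShapeCertVQ.checkQS M = true := by
  interval_cases M
  · exact ShapeCertVQ.checkQS_418
  · exact ShapeCertVQ.checkQS_419
  · exact ShapeCertVQ.checkQS_420
  · exact ShapeCertVQ.checkQS_421
  · exact ShapeCertVQ.checkQS_422
  · exact ShapeCertVQ.checkQS_423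
  · exact ShapeCertVQ.checkQS_424
  · exact ShapeCertVQ.checkQS_425
  · exact ShapeCertVQ.checkQS_426
  · exact ShapeCertVQ.checkQS_427
  · exact ShapeCertVQ.checkQS_428
  · exact ShapeCertVQ.checkQS_429
  · exact ShapeCertVQ.checkQS_430
  · exact ShapeCertVQ.checkQS_431
  · exact ShapeCertVQ.checkQS_432
  · exact ShapeCertVQ.checkQS_433
  · exact ShapeCertVQ.checkQS_434
  · exact ShapeCertVQ.checkQS_435
  · exact ShapeCertVQ.checkQS_436
  · exact ShapeCertVQ.checkQS_437
  · exact ShapeCertVQ.checkQS_438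
  · exact ShapeCertVQ.checkQS_439
  · exact ShapeCertVQ.checkQS_440
  · exact ShapeCertVQ.checkQS_441
  · exact ShapeCertVQ.checkQS_442
  · exact ShapeCertVQ.checkQS_443
  · exact ShapeCertVQ.checkQS_444
  · exact ShapeCertVQ.checkQS_445
  · exact ShapeCertVQ.checkQS_446
  · exact ShapeCertVQ.checkQS_447
  · exact ShapeCertVQ.checkQS_448
  · exact ShapeCertVQ.checkQS_449
  · exact ShapeCertVQ.checkQS_450
  · exact ShapeCertVQ.checkQS_451
  · exact ShapeCertVQ.checkQS_452
  · exact ShapeCertVQ.checkQS_453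
  · exact ShapeCertVQ.checkQS_454
  · exact ShapeCertVQ.checkQS_455
  · exact ShapeCertVQ.checkQS_456
  · exact ShapeCertVQ.checkQS_457
  · exact ShapeCertVQ.checkQS_458
  · exact ShapeCertVQ.checkQS_459
  · exact ShapeCertVQ.checkQS_460
  · exact ShapeCertVQ.checkQS_461
  · exact ShapeCertVQ.checkQS_462
  · exact ShapeCertVQ.checkQS_463
  · exact ShapeCertVQ.checkQS_464
  · exact ShapeCertVQ.checkQS_465
  · exact ShapeCertVQ.checkQS_466
  · exact ShapeCertVQ.checkQS_467
  · exact ShapeCertVQ.checkQS_468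
  · exact ShapeCertVQ.checkQS_469
  · exact ShapeCertVQ.checkQS_470
  · exact ShapeCertVQ.checkQS_471

/-- **vQ shape exclusion for `T_E` (`τ = 5/2`) at the orders `338 ≤ M ≤ 471`**: no shape list with at least two members that
satisfies the vP sieve system and the E3⁺ condition beats `5/2`. [original] -/
theorem shapeExclusionVQ_338_471 : ∀ (N M : ℕ) (a b c : Fin N → ℕ), 2 ≤ N → 338 ≤ M → M ≤ 471 →
    SieveAdmissibleVP M a b c → E3pAdm M a b c → ¬ Beats (5 / 2) M a b c := by
  intro N M a b c hN h₁ h₂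
  rcases Nat.lt_or_ge M 418 with k | g
  · exact shapeExclusionVQ_338_417 N M a b c hN h₁ (by omega)
  · exact ShapeCertVQ.shapeExclusionVQ_of_checkQS (by omega) (ShapeCertVQ.checkQS_418_471 M g h₂) N a b c hN

/-- **Rung leaf T_E/471 (closed, beyond the vP wall).** No finite abelian group of order at most `471` hosts an STPP family
beating exponent `5/2`: `Σ_i (|A_i||B_i||C_i|)^{5/6} ≤ |H|` for every STPP family in every such `H`. [original] -/
theorem noAbelianSTPPHostUpTo_250_471 : NoAbelianSTPPHostUpTo (5 / 2) 471 := by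
  classical
  refine AbelianTECensus.noAbelianSTPPHostUpTo_of_two (τ := 5 / 2) (by norm_num) (by norm_num) ?_
  intro H _ _ hM N A B C hS hne hN
  by_cases h337 : Fintype.card H ≤ 337
  · exact noAbelianSTPPHost_250_337 H h337 N A B C hS
  · have hadm : SieveAdmissibleVP (Fintype.card H) (fun i => (A i).card) (fun i => (B i).card) (fun i => (C i).card) :=
      ⟨AbelianTECensus.sieveSound H N A B C hS hne, u11GSound_holds H N A B C hS hne,
        fun hp => STPPRepCount.u11PSound H hp N A B C hS hne⟩
    have hE : E3pAdm (Fintype.card H) (fun i => (A i).card) (fun i => (B i).card) (fun i => (C i).card) :=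
      e3pAdm_of_isSTPP hS hne
    have h := shapeExclusionVQ_338_471 N (Fintype.card H) _ _ _ hN (by omega) hM hadm hE
    unfold Beats at h
    push Not at h
    simpa [shapeVol] using h

/-- **The registered instrument vQ := vP ∧ E3⁺ certifies T_E EXACTLY up to order 471**: at every order `M ≤ 471` no shape list
with at least two members that is vP-admissible and E3⁺-admissible beats `5/2` (`≤ 337`: the crux `ShapeExclusionVP337`; `338–471`:
`shapeExclusionVQ_338_471`), and at order `472` one does (`AbelianSTPPCensusVP.vqpCensusTE_false_above_472`, the list
`(6,6,8)⁴ + (3,4,4)` of `…VQWitness472`).  So the first vQ-alive order for T_E is exactly `472`. [original] -/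
theorem vqInstrumentTE_exact_471 :
    (∀ (N M : ℕ) (a b c : Fin N → ℕ), 2 ≤ N → M ≤ 471 → SieveAdmissibleVP M a b c → E3pAdm M a b c → ¬ Beats (5 / 2) M a b c) ∧
    ¬ (∀ (N M : ℕ) (a b c : Fin N → ℕ), 2 ≤ N → M ≤ 472 → SieveAdmissibleVP M a b c → E3pAdm M a b c →
        ¬ Beats (5 / 2) M a b c) :=
  ⟨fun N M a b c hN hM hVP hE => by
    rcases Nat.lt_or_ge M 338 with h | h
    · exact ShapeExclusionVP337_proof N M a b c hN (by omega) hVP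
    · exact shapeExclusionVQ_338_471 N M a b c hN h hM hVP hE,
   AbelianSTPPCensusVP.vqpCensusTE_false_above_472 le_rfl⟩

end Summit.MatrixMultiplication.MatrixMultiplication.Theorems
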